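import Summits.AnomalousDissipation.AnomalousDissipation.Theorems.DriftStatesAreLerayHopf.Negative.DriftModeDissipation

/-!
# Every Leray–Hopf solution from drift-mode data is the steady drifted mode; at the Kolmogorov
force the drift data are bounded AND quiet for every choice of solutions

Negative-lane file (small-model facts; no Theses statement is asserted). By the forced weak–strong
uniqueness on `T³` (`Torus.IsGlobalLerayHopf.ae_eq_of_isClassicalNSSolutionOn_univ_forced`) and
`isClassicalNSSolutionOn_driftMode`, every global Leray–Hopf solution with the matched single-mode
force and the drifted mode `d = W + a sin v + b cos v` as datum IS `d` a.e. for all `t > 0`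
(`ae_eq_driftMode_of_isGlobalLerayHopf`); hence its long-time means are those of `d`
(`meanEnergy_eq_of_isGlobalLerayHopf_driftMode`, `meanDissipation_eq_…`). For the Kolmogorov drift
states (force `sin(4πx₁)e₀`, drift `V e₁`, `V ≠ 0`): EVERY Leray–Hopf solution from the drift datum
has `⟨‖u‖²⟩ = V² + 1/(32π²(V² + 16π²ν²)) ≤ V² + 1/(32π²V²)` and `⟨ν‖∇u‖²⟩ = ν/(2(V² + 16π²ν²))
≤ ν/(2V²)` — so along ANY viscosity sequence `νⱼ → 0` the drift data give uniformly bounded energy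
and dissipation `→ 0` for every choice of solutions: the zeroth-law shape fails on this data family
for the opposite reason to the rest/laminar data of `SingleModeLaminarUnique`
(`not_zerothLaw_shape_kolmogorov_rest`: energy unbounded) — `not_zerothLaw_shape_kolmogorovDrift`.
-/

noncomputable section
-- the mandated namespace `Summit.<Summit>.<Problem>.Theorems` repeats `AnomalousDissipation` (single-problem summit)
set_option linter.dupNamespace false

namespace Summit.AnomalousDissipation.AnomalousDissipation.Theorems.DriftStatesAreLerayHopf.Negative

open MeasureTheory Set Filter Topology UnitAddTorus
open scoped ENNReal NNReal InnerProductSpace ContDiff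
open Literature.Analysis.FunctionSpaces Literature.Analysis.FunctionSpaces.Torus
open Literature.Analysis.FluidPDE Literature.Analysis.FluidPDE.Torus

variable {k : Fin 3 → ℤ} {v : EuclideanSpace ℝ (Fin 3)}

/-- The spectral `‖∇·‖₂²` only sees the a.e.-class. [folklore] -/
private theorem eGradNormSq_congr_ae₃ {f g : UnitAddTorus (Fin 3) → EuclideanSpace ℝ (Fin 3)}
    (h : f =ᵐ[volume] g) : eGradNormSq f = eGradNormSq g := by
  have h' : (EuclideanSpace.complexify ∘ f) =ᵐ[volume] (EuclideanSpace.complexify ∘ g) :=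
    h.fun_comp EuclideanSpace.complexify
  unfold eGradNormSq eHomSobolevSeminorm
  simp_rw [mFourierCoeff_congr_ae h']

/-! ## 1. Uniqueness from drift-mode data -/

/-- **Every Leray–Hopf solution from a drifted mode is that steady mode** (forced weak–strong
uniqueness against the classical steady solution `isClassicalNSSolutionOn_driftMode`). [folklore] -/
theorem ae_eq_driftMode_of_isGlobalLerayHopf (hkv : ⟪latticeVec k, v⟫_ℝ = 0) (W : EuclideanSpace ℝ (Fin 3))
    (a b : ℝ) {ν : ℝ} (hν : 0 ≤ ν) {u : ℝ → UnitAddTorus (Fin 3) → EuclideanSpace ℝ (Fin 3)}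
    (hu : IsGlobalLerayHopf ν
      (fun _ (x : UnitAddTorus (Fin 3)) =>
        (ν * stokesEigenvalue k * a - 2 * Real.pi * ⟪latticeVec k, W⟫_ℝ * b) • stokesMode k v false x +
          (ν * stokesEigenvalue k * b + 2 * Real.pi * ⟪latticeVec k, W⟫_ℝ * a) • stokesMode k v true x)
      (fun x : UnitAddTorus (Fin 3) => W + a • stokesMode k v false x + b • stokesMode k v true x) u) :
    ∀ t, 0 < t → u t =ᵐ[volume]
      fun x : UnitAddTorus (Fin 3) => W + a • stokesMode k v false x + b • stokesMode k v true x :=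
  hu.ae_eq_of_isClassicalNSSolutionOn_univ_forced (isClassicalNSSolutionOn_driftMode hkv W a b ν) hν

/-- **Mean energy of any Leray–Hopf solution from a drifted mode** `= ‖W‖² + ½‖v‖²(a² + b²)`. [folklore] -/
theorem meanEnergy_eq_of_isGlobalLerayHopf_driftMode (hk : k ≠ 0) (hkv : ⟪latticeVec k, v⟫_ℝ = 0)
    (W : EuclideanSpace ℝ (Fin 3)) (a b : ℝ) {ν : ℝ} (hν : 0 ≤ ν)
    {u : ℝ → UnitAddTorus (Fin 3) → EuclideanSpace ℝ (Fin 3)}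
    (hu : IsGlobalLerayHopf ν
      (fun _ (x : UnitAddTorus (Fin 3)) =>
        (ν * stokesEigenvalue k * a - 2 * Real.pi * ⟪latticeVec k, W⟫_ℝ * b) • stokesMode k v false x +
          (ν * stokesEigenvalue k * b + 2 * Real.pi * ⟪latticeVec k, W⟫_ℝ * a) • stokesMode k v true x)
      (fun x : UnitAddTorus (Fin 3) => W + a • stokesMode k v false x + b • stokesMode k v true x) u) :
    meanEnergy u = ‖W‖ ^ 2 + ‖v‖ ^ 2 / 2 * (a ^ 2 + b ^ 2) := by
  rw [← meanEnergy_driftMode hk v W a b, meanEnergy_eq_longTimeAvgSup, meanEnergy_eq_longTimeAvgSup]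
  refine longTimeAvgSup_congr_of_eqOn_Ioi fun t ht => integral_congr_ae ?_
  filter_upwards [ae_eq_driftMode_of_isGlobalLerayHopf hkv W a b hν hu t ht] with x hx
  rw [hx]

/-- **Mean dissipation of any Leray–Hopf solution from a drifted mode** `= νλ·½‖v‖²(a² + b²)`. [folklore] -/
theorem meanDissipation_eq_of_isGlobalLerayHopf_driftMode (hk : k ≠ 0) (hkv : ⟪latticeVec k, v⟫_ℝ = 0)
    (W : EuclideanSpace ℝ (Fin 3)) (a b : ℝ) {ν : ℝ} (hν : 0 ≤ ν)
    {u : ℝ → UnitAddTorus (Fin 3) → EuclideanSpace ℝ (Fin 3)}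
    (hu : IsGlobalLerayHopf ν
      (fun _ (x : UnitAddTorus (Fin 3)) =>
        (ν * stokesEigenvalue k * a - 2 * Real.pi * ⟪latticeVec k, W⟫_ℝ * b) • stokesMode k v false x +
          (ν * stokesEigenvalue k * b + 2 * Real.pi * ⟪latticeVec k, W⟫_ℝ * a) • stokesMode k v true x)
      (fun x : UnitAddTorus (Fin 3) => W + a • stokesMode k v false x + b • stokesMode k v true x) u) :
    meanDissipation ν u = ν * (stokesEigenvalue k * (‖v‖ ^ 2 / 2 * (a ^ 2 + b ^ 2))) := by
  rw [← meanDissipation_driftMode hk v W a b ν]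
  unfold meanDissipation
  refine longTimeAvgSup_congr_of_eqOn_Ioi fun t ht => ?_
  rw [eGradNormSq_congr_ae₃ (ae_eq_driftMode_of_isGlobalLerayHopf hkv W a b hν hu t ht)]

/-! ## 2. The Kolmogorov drift data: bounded and quiet for every choice of solutions -/

/-- **Means of EVERY Leray–Hopf solution from the Kolmogorov drift datum** (force `sin(4πx₁)e₀`,
datum `V e₁ + (ν/D) sin(4πx₁)e₀ − (V/(4πD)) cos(4πx₁)e₀`, `D = V² + 16π²ν²`, `ν > 0`):
`⟨‖u‖²⟩ = V² + 1/(32π²D)` and `⟨ν‖∇u‖²⟩ = ν/(2D)`. [folklore] -/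
theorem means_eq_of_isGlobalLerayHopf_kolmogorovDrift (V : ℝ) {ν : ℝ} (hν : 0 < ν)
    {u : ℝ → UnitAddTorus (Fin 3) → EuclideanSpace ℝ (Fin 3)}
    (hu : IsGlobalLerayHopf ν
      (fun _ => ⇑(stokesMode (![0, 2, 0] : Fin 3 → ℤ) (EuclideanSpace.single (0 : Fin 3) (1 : ℝ)) false))
      (fun x : UnitAddTorus (Fin 3) => V • EuclideanSpace.single (1 : Fin 3) (1 : ℝ) +
        (ν / (V ^ 2 + 16 * Real.pi ^ 2 * ν ^ 2)) •
          (stokesMode (![0, 2, 0] : Fin 3 → ℤ) (EuclideanSpace.single (0 : Fin 3) (1 : ℝ)) false x) +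
        (-V / (4 * Real.pi * (V ^ 2 + 16 * Real.pi ^ 2 * ν ^ 2))) •
          (stokesMode (![0, 2, 0] : Fin 3 → ℤ) (EuclideanSpace.single (0 : Fin 3) (1 : ℝ)) true x)) u) :
    meanEnergy u = V ^ 2 + 1 / (32 * Real.pi ^ 2 * (V ^ 2 + 16 * Real.pi ^ 2 * ν ^ 2)) ∧
      meanDissipation ν u = ν / (2 * (V ^ 2 + 16 * Real.pi ^ 2 * ν ^ 2)) := by
  have hk : (![0, 2, 0] : Fin 3 → ℤ) ≠ 0 := fun h => by simpa using congrFun h 1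
  have hkv : ⟪latticeVec (![0, 2, 0] : Fin 3 → ℤ), EuclideanSpace.single (0 : Fin 3) (1 : ℝ)⟫_ℝ = 0 := by
    rw [EuclideanSpace.inner_single_right, latticeVec_apply]
    simp
  have hD : V ^ 2 + 16 * Real.pi ^ 2 * ν ^ 2 ≠ 0 := by positivity
  have hπ : Real.pi ≠ 0 := Real.pi_ne_zero
  have hs : ν * (16 * Real.pi ^ 2) * (ν / (V ^ 2 + 16 * Real.pi ^ 2 * ν ^ 2)) -
      2 * Real.pi * (2 * V) * (-V / (4 * Real.pi * (V ^ 2 + 16 * Real.pi ^ 2 * ν ^ 2))) = 1 := by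
    field_simp
    ring
  have hc : ν * (16 * Real.pi ^ 2) * (-V / (4 * Real.pi * (V ^ 2 + 16 * Real.pi ^ 2 * ν ^ 2))) +
      2 * Real.pi * (2 * V) * (ν / (V ^ 2 + 16 * Real.pi ^ 2 * ν ^ 2)) = 0 := by
    field_simp
    ring
  have hE := fun (w : ℝ → UnitAddTorus (Fin 3) → EuclideanSpace ℝ (Fin 3)) =>
    meanEnergy_eq_of_isGlobalLerayHopf_driftMode (u := w) hk hkv (V • EuclideanSpace.single (1 : Fin 3) (1 : ℝ))
      (ν / (V ^ 2 + 16 * Real.pi ^ 2 * ν ^ 2)) (-V / (4 * Real.pi * (V ^ 2 + 16 * Real.pi ^ 2 * ν ^ 2))) hν.le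
  have hF := fun (w : ℝ → UnitAddTorus (Fin 3) → EuclideanSpace ℝ (Fin 3)) =>
    meanDissipation_eq_of_isGlobalLerayHopf_driftMode (u := w) hk hkv (V • EuclideanSpace.single (1 : Fin 3) (1 : ℝ))
      (ν / (V ^ 2 + 16 * Real.pi ^ 2 * ν ^ 2)) (-V / (4 * Real.pi * (V ^ 2 + 16 * Real.pi ^ 2 * ν ^ 2))) hν.le
  rw [stokesEigenvalue_kolmogorov, inner_latticeVec_kolmogorov_drift, hs, hc] at hE hF
  simp only [one_smul, zero_smul, add_zero] at hE hF
  refine ⟨?_, ?_⟩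
  · rw [hE u hu]
    simp [norm_smul]
    field_simp
    ring
  · rw [hF u hu]
    simp
    field_simp
    ring

/-- **Bounded and quiet — for every choice of solutions** (`V ≠ 0`):
`⟨‖u‖²⟩ ≤ V² + 1/(32π²V²)` and `⟨ν‖∇u‖²⟩ ≤ ν/(2V²)` for every Leray–Hopf solution from the
Kolmogorov drift datum at viscosity `ν > 0`. [folklore] -/
theorem means_le_of_isGlobalLerayHopf_kolmogorovDrift {V : ℝ} (hV : V ≠ 0) {ν : ℝ} (hν : 0 < ν)
    {u : ℝ → UnitAddTorus (Fin 3) → EuclideanSpace ℝ (Fin 3)}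
    (hu : IsGlobalLerayHopf ν
      (fun _ => ⇑(stokesMode (![0, 2, 0] : Fin 3 → ℤ) (EuclideanSpace.single (0 : Fin 3) (1 : ℝ)) false))
      (fun x : UnitAddTorus (Fin 3) => V • EuclideanSpace.single (1 : Fin 3) (1 : ℝ) +
        (ν / (V ^ 2 + 16 * Real.pi ^ 2 * ν ^ 2)) •
          (stokesMode (![0, 2, 0] : Fin 3 → ℤ) (EuclideanSpace.single (0 : Fin 3) (1 : ℝ)) false x) +
        (-V / (4 * Real.pi * (V ^ 2 + 16 * Real.pi ^ 2 * ν ^ 2))) •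
          (stokesMode (![0, 2, 0] : Fin 3 → ℤ) (EuclideanSpace.single (0 : Fin 3) (1 : ℝ)) true x)) u) :
    meanEnergy u ≤ V ^ 2 + 1 / (32 * Real.pi ^ 2 * V ^ 2) ∧ meanDissipation ν u ≤ ν / (2 * V ^ 2) := by
  obtain ⟨hE, hF⟩ := means_eq_of_isGlobalLerayHopf_kolmogorovDrift V hν hu
  have hV2 : 0 < V ^ 2 := by positivity
  have hD : V ^ 2 ≤ V ^ 2 + 16 * Real.pi ^ 2 * ν ^ 2 := le_add_of_nonneg_right (by positivity)
  refine ⟨?_, ?_⟩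
  · rw [hE]
    gcongr
  · rw [hF]
    gcongr

/-- **No zeroth-law shape along the Kolmogorov drift data** (`V ≠ 0`): for ANY viscosities
`νⱼ > 0` with `νⱼ → 0` and ANY global Leray–Hopf solutions `uⱼ` from the drift data, the mean
energies are bounded by `V² + 1/(32π²V²)` but no `ε > 0` bounds the mean dissipations below
(they are `νⱼ/(2Dⱼ) ≤ νⱼ/(2V²) → 0`) — the opposite failure mode to the rest/laminar data
(`RestMeanFloorTG.Negative.not_zerothLaw_shape_kolmogorov_rest`: energy unbounded). [folklore] -/
theorem not_zerothLaw_shape_kolmogorovDrift {V : ℝ} (hV : V ≠ 0) {ν : ℕ → ℝ} (hν : ∀ j, 0 < ν j)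
    (hν0 : Tendsto ν atTop (𝓝 0)) {u : ℕ → ℝ → UnitAddTorus (Fin 3) → EuclideanSpace ℝ (Fin 3)}
    (hu : ∀ j, IsGlobalLerayHopf (ν j)
      (fun _ => ⇑(stokesMode (![0, 2, 0] : Fin 3 → ℤ) (EuclideanSpace.single (0 : Fin 3) (1 : ℝ)) false))
      (fun x : UnitAddTorus (Fin 3) => V • EuclideanSpace.single (1 : Fin 3) (1 : ℝ) +
        (ν j / (V ^ 2 + 16 * Real.pi ^ 2 * ν j ^ 2)) •
          (stokesMode (![0, 2, 0] : Fin 3 → ℤ) (EuclideanSpace.single (0 : Fin 3) (1 : ℝ)) false x) +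
        (-V / (4 * Real.pi * (V ^ 2 + 16 * Real.pi ^ 2 * ν j ^ 2))) •
          (stokesMode (![0, 2, 0] : Fin 3 → ℤ) (EuclideanSpace.single (0 : Fin 3) (1 : ℝ)) true x)) (u j)) :
    (∀ j, meanEnergy (u j) ≤ V ^ 2 + 1 / (32 * Real.pi ^ 2 * V ^ 2)) ∧
      ¬ ∃ ε : ℝ, 0 < ε ∧ ∀ j, ε ≤ meanDissipation (ν j) (u j) := by
  refine ⟨fun j => (means_le_of_isGlobalLerayHopf_kolmogorovDrift hV (hν j) (hu j)).1, ?_⟩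
  rintro ⟨ε, hε, hεj⟩
  have hV2 : 0 < V ^ 2 := by positivity
  have hev : ∀ᶠ j in atTop, ν j < 2 * V ^ 2 * ε :=
    hν0.eventually (gt_mem_nhds (by positivity : (0 : ℝ) < 2 * V ^ 2 * ε))
  obtain ⟨j, hj⟩ := hev.exists
  have h1 := (means_le_of_isGlobalLerayHopf_kolmogorovDrift hV (hν j) (hu j)).2
  have h2 : ν j / (2 * V ^ 2) < ε := by
    rw [div_lt_iff₀ (by positivity)]
    linarith
  linarith [hεj j]

end Summit.AnomalousDissipation.AnomalousDissipation.Theorems.DriftStatesAreLerayHopf.Negative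

end
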